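import Mathlib
import HarnessLib

/-!
# The multiplicative autocorrelation `A(λ) = ∫₀^∞ {t}{λt} dt/t²` of the fractional part and Vasyunin's cotangent sums
(Báez-Duarte–Balazard–Landreau–Saias)

Topic `NumberTheory/LFunctions`, next to `NymanBeurling*.lean` (Báez-Duarte's criterion `baezDuarte_iff`, the dilates
`ρ_a(x) = {1/(ax)}`) and `NymanBeurlingRate.lean` (`baezDuarteDistSqOf`).  The Gram matrix of the finite Nyman–Beurling /
Báez-Duarte least-squares problem — the object every numerical study of the criterion computes (Landreau–Richard 2002;
cell `pub/rh-li`, DATA.md §L) — is `⟨ρ_a, ρ_b⟩_{L²(0,∞)} = A(a/b)/a` (`integral_Ioi_fract_mul_fract_eq_fractAutocorr` below),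
where `A` is the multiplicative autocorrelation of the fractional part; its closed form at rationals is Vasyunin's
cotangent formula.

## Source, verbatim

L. Báez-Duarte, M. Balazard, B. Landreau, E. Saias, *Sur l'autocorrélation multiplicative de la fonction partie
fractionnaire*, arXiv:math/0306251 (2003) — the authors' detailed working document («document de travail, contenant les
prérequis et les détails des calculs») for *Étude de l'autocorrélation multiplicative de la fonction ‘partie
fractionnaire’*, Ramanujan J. 9 (2005) 215–240.  Numbering below is that of the arXiv document (read: pp. 8, 16–17 of
`paper:arxiv-math_0306251`).

* §4, before Prop. 37: «Si `p` et `q` sont deux nombres entiers premiers entre eux, `q` étant positif, nous définissons la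
  somme de Vassiounine `V(p,q)` par la formule `V(p,q) := Σ_{k=1}^{q−1} {kp/q} cot(kπ/q) = (1/q) Σ_{k=1}^{q−1} (kp mod q) cot(kπ/q)`
  … Par convention, `V(p,1) = 0`.»
* §9.1: «La fonction d'autocorrélation multiplicative de la fonction partie fractionnaire est définie pour `λ ≥ 0` par
  l'intégrale `A(λ) := ∫_0^{+∞} {t}{λt} dt/t²`.»
* Prop. 85: «`A(λ)` est une fonction continue de `λ` pour `λ ≥ 0`, et `A(λ) = λ A(1/λ)`, `λ > 0`.»
* Prop. 87: «`A(1) = log 2π − γ`.»  (Proof printed: `A(1) = ∫_0^∞ {t}² t⁻² dt = ∫_0^1 t² ψ′(t) dt = log 2π − γ`.)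
* Prop. 89: «Soit `p` et `q` deux nombres entiers positifs premiers entre eux et `λ = p/q`.  On a
  `A(λ) = (1−λ)/2 · log λ + (λ+1)/2 · (log 2π − γ) − (π/(2q)) (V(p,q) + V(q,p))`.»  (Vasyunin 1996.)

## Design

* `fractAutocorr λ` is the Bochner set integral over `Ioi 0` of the real integrand `{t}{λt}/t²` (integrable for every
  `λ ≥ 0`: bounded by `t⁻²` at infinity and by `λ` near `0`; we do not need and do not prove integrability here).
* `vasyuninCotSum p q` takes `p : ℤ`, `q : ℕ` and sums over `k ∈ [1, q)`; `V(p,1) = 0` is the empty sum.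
* PROVED here: the dilation symmetry Prop. 85 (`fractAutocorr_eq_mul_fractAutocorr_inv`, change of variables) and the
  Gram-matrix dictionary `∫_0^∞ {1/(ax)}{1/(bx)} dx = A(a/b)/a` (`integral_Ioi_fract_mul_fract_eq_fractAutocorr`;
  substitutions `x ↦ 1/x`, `y ↦ a u`).  NAMED FACTS: Prop. 87 (`BBLS2003_prop87`; an equivalent statement,
  `∫_{(0,∞)} {1/x}² dx = log 2π − γ`, is PROVED summit-side as `Summit.RiemannHypothesis.RiemannHypothesis.Theorems.NbTheory.nbGram_zero_zero`,
  whence `BBLS2003_prop87` is discharged there) and Prop. 89 (`BBLS2003_prop89`, Vasyunin's formula; not proved in the tree).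
* Deliberately NOT here: `φ₁`, `φ₂` and Prop. 88/90 (conditionally convergent series), the reciprocity law of `V`.

## References

* [BBLS2003AutocorrelationNotes] L. Báez-Duarte, M. Balazard, B. Landreau, E. Saias, Sur l'autocorrélation multiplicative de
  la fonction partie fractionnaire, arXiv:math/0306251; published as Ramanujan J. 9 (2005) 215–240.
* [Vasyunin1996] V. I. Vasyunin, On a biorthogonal system related with the Riemann hypothesis, St. Petersburg Math. J. 7
  (1996) 405–419.
* [LandreauRichard2002] B. Landreau, F. Richard, Le critère de Beurling et Nyman pour l'hypothèse de Riemann: aspects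
  numériques, Experiment. Math. 11 (2002) 349–360.
-/

noncomputable section

namespace Literature.NumberTheory.LFunctions

open _root_.MeasureTheory _root_.Set

/-- The multiplicative autocorrelation of the fractional part, `A(λ) := ∫_0^{+∞} {t}{λt} dt/t²` (`λ ≥ 0`), as a Bochner
integral over `(0,∞)`. [cite: BBLS2003AutocorrelationNotes, §9.1 (definition of A)] -/
def fractAutocorr (lam : ℝ) : ℝ :=
  ∫ t in Ioi (0 : ℝ), Int.fract t * Int.fract (lam * t) / t ^ 2

/-- Vasyunin's cotangent sum `V(p,q) := Σ_{k=1}^{q−1} {kp/q} cot(kπ/q)` (`p, q` coprime, `q ≥ 1`; `V(p,1) = 0` is the empty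
sum). [cite: BBLS2003AutocorrelationNotes, §4 (definition of V(p,q), before Prop. 37)] -/
def vasyuninCotSum (p : ℤ) (q : ℕ) : ℝ :=
  ∑ k ∈ Finset.Ico 1 q, Int.fract ((k : ℝ) * p / q) * Real.cot ((k : ℝ) * Real.pi / q)

/-- **Prop. 85 (dilation symmetry):** `A(λ) = λ A(1/λ)` for `λ > 0` («Cela résulte du changement de variable `u = λt`»).
[cite: BBLS2003AutocorrelationNotes, Prop. 85] -/
theorem fractAutocorr_eq_mul_fractAutocorr_inv {lam : ℝ} (hlam : 0 < lam) :
    fractAutocorr lam = lam * fractAutocorr (1 / lam) := by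
  unfold fractAutocorr
  -- `{t}{λt}/t² = g(λ t)` with `g(u) = λ² {u/λ}{u}/u²`
  have hg : ∀ t ∈ Ioi (0 : ℝ), Int.fract t * Int.fract (lam * t) / t ^ 2 =
      (fun u : ℝ ↦ lam ^ 2 * (Int.fract (u / lam) * Int.fract u / u ^ 2)) (lam * t) := by
    intro t ht
    have ht0 : (t : ℝ) ≠ 0 := (ne_of_gt ht)
    simp only
    rw [mul_div_cancel_left₀ t hlam.ne']
    field_simp
  rw [setIntegral_congr_fun measurableSet_Ioi hg,
    integral_comp_mul_left_Ioi (fun u : ℝ ↦ lam ^ 2 * (Int.fract (u / lam) * Int.fract u / u ^ 2)) 0 hlam,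
    mul_zero, integral_const_mul, smul_eq_mul]
  have hc : ∫ u in Ioi (0 : ℝ), Int.fract (u / lam) * Int.fract u / u ^ 2 =
      ∫ u in Ioi (0 : ℝ), Int.fract u * Int.fract (1 / lam * u) / u ^ 2 := by
    refine setIntegral_congr_fun measurableSet_Ioi fun u _ ↦ ?_
    rw [one_div_mul_eq_div, mul_comm (Int.fract (u / lam))]
  rw [hc]
  field_simp

/-- **The Gram-matrix dictionary:** for `a > 0` (and any `b`; `b > 0` is the case of interest),
`∫_0^∞ {1/(ax)}{1/(bx)} dx = A(a/b)/a` — the inner product of the Beurling–Báez-Duarte dilates `ρ_a, ρ_b` in `L²(0,∞)` is the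
autocorrelation at `λ = a/b` (substitute `x ↦ 1/x`, then `y = a u`; cf. §8.2, `A_φ(λ) = √λ ⟨φ, K_λφ⟩`).
[cite: BBLS2003AutocorrelationNotes, §8.2 and §9.1] -/
theorem integral_Ioi_fract_mul_fract_eq_fractAutocorr {a : ℝ} (b : ℝ) (ha : 0 < a) :
    ∫ x in Ioi (0 : ℝ), Int.fract (1 / (a * x)) * Int.fract (1 / (b * x)) = fractAutocorr (a / b) / a := by
  -- Step 1: `x ↦ x⁻¹`
  set g : ℝ → ℝ := fun y ↦ Int.fract (y / a) * Int.fract (y / b) / y ^ 2 with hg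
  have h1 : ∫ x in Ioi (0 : ℝ), Int.fract (1 / (a * x)) * Int.fract (1 / (b * x)) = ∫ y in Ioi (0 : ℝ), g y := by
    rw [← integral_comp_rpow_Ioi g (show (-1 : ℝ) ≠ 0 by norm_num)]
    refine setIntegral_congr_fun measurableSet_Ioi fun x hx ↦ ?_
    have hx0 : 0 < x := hx
    have e1 : x ^ (-1 : ℝ) = x⁻¹ := Real.rpow_neg_one x
    have e2 : x ^ ((-1 : ℝ) - 1) = (x ^ 2)⁻¹ := by
      rw [show ((-1 : ℝ) - 1) = -(2 : ℝ) by norm_num, Real.rpow_neg hx0.le, Real.rpow_two]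
    simp only [hg, e1, e2, smul_eq_mul, abs_neg, abs_one, one_mul]
    have hx' : x ≠ 0 := hx0.ne'
    field_simp
  -- Step 2: `y = a u`
  have h2 : ∫ y in Ioi (0 : ℝ), g y = a * ∫ u in Ioi (0 : ℝ), g (a * u) := by
    rw [integral_comp_mul_left_Ioi g 0 ha, mul_zero, smul_eq_mul, ← mul_assoc, mul_inv_cancel₀ ha.ne', one_mul]
  have h3 : ∫ u in Ioi (0 : ℝ), g (a * u) = a⁻¹ ^ 2 * fractAutocorr (a / b) := by
    rw [fractAutocorr, ← integral_const_mul]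
    refine setIntegral_congr_fun measurableSet_Ioi fun u hu ↦ ?_
    have hu0 : (u : ℝ) ≠ 0 := (ne_of_gt hu)
    simp only [hg]
    rw [mul_div_cancel_left₀ u ha.ne', show a * u / b = a / b * u by ring]
    field_simp
  rw [h1, h2, h3]
  field_simp

/-- **Prop. 87, NAMED FACT:** `A(1) = log 2π − γ` (printed proof: `∫_0^∞ {t}² t⁻² dt = ∫_0^1 t²ψ′(t) dt = log 2π − γ`).
The equivalent statement `∫_{(0,∞)} {1/x}² dx = log 2π − γ` is PROVED summit-side
(`Summit.RiemannHypothesis.RiemannHypothesis.Theorems.NbTheory.nbGram_zero_zero`, via Farey cells and Stirling), which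
discharges this fact through `integral_Ioi_fract_mul_fract_eq_fractAutocorr`. Users take `(h : BBLS2003_prop87)`.
[cite: BBLS2003AutocorrelationNotes, Prop. 87] -/
def BBLS2003_prop87 : Prop :=
  fractAutocorr 1 = Real.log (2 * Real.pi) - Real.eulerMascheroniConstant

/-- **Prop. 89, NAMED FACT (Vasyunin's formula):** for coprime positive integers `p, q` and `λ = p/q`,
`A(λ) = (1−λ)/2 · log λ + (λ+1)/2 · (log 2π − γ) − (π/(2q))·(V(p,q) + V(q,p))` — the closed form behind every numerical
Gram matrix of the Nyman–Beurling problem (Vasyunin 1996; Landreau–Richard 2002, Thm. 2.1). Not proved in the tree.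
Users take `(h : BBLS2003_prop89)`. [cite: BBLS2003AutocorrelationNotes, Prop. 89] -/
def BBLS2003_prop89 : Prop :=
  ∀ p q : ℕ, 0 < p → 0 < q → Nat.Coprime p q →
    fractAutocorr ((p : ℝ) / q) =
      (1 - (p : ℝ) / q) / 2 * Real.log ((p : ℝ) / q)
        + ((p : ℝ) / q + 1) / 2 * (Real.log (2 * Real.pi) - Real.eulerMascheroniConstant)
        - Real.pi / (2 * q) * (vasyuninCotSum p q + vasyuninCotSum q p)

end Literature.NumberTheory.LFunctions

end
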